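import Summits.QuantumAdvantage.AdviceFreeQNC0.SeedJuntaSlack39Walk
import HarnessLib

/-!
# Cell qa-qnc0, `p = 3` — the unconditional structured branch with the TOLERANCE BUDGET VERBATIM (`3·#W ≤ N`); only the seed schedule
# carries the slack (prover qn-prover-3 g27; sequel of `SeedJuntaSlack39` / `SeedJuntaSlack39Walk`)

`SeedJuntaSlack39.seedJuntaHardXS_slack` enlarged the tolerance set for BOTH terms of the graded expansion and so asked for the budget
`3·#W + 3·N/(log₂N)^E ≤ N`.  Unnecessary: the reduction consumes the twisted bound SEPARATELY for each frozen seed residue and dual vector,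
while the main term (`AffBells34.coverPolylogHard`) sees only `W`; so the enlargement `W ↦ W'` (`AffBells22.exists_coDegree_tolerance`) is done
INSIDE each twisted estimate and never leaves it.  §1 `AffBells22.norm_twistedWinSum_le_slack`: an (R1)-SHAPED BOUND FOR EVERY READ FAMILY
at the original `W` — `‖Σ_x e₃(β·x)[OddZeros ∧ Rel]‖ ≤ 2·(39/40)^{(#(supp β∖W) − N/(log₂N)^E)/(log₂N)^{2C+E}}·2^N` for `N ≥ 4`, reads
`#(T k∖W) ≤ (log₂N)^C`, no overlap hypothesis.  §2 `GradedSeeds38.seedJuntaHard_of_slackR1` (the graded-seed reduction for a twisted bound with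
exponent `(#(supp β∖W) − slack C N)/lvl C N`, main-term constant explicit; proof = `seedJuntaHard_of_restrictedR1C` verbatim) and
★★ `GradedSeeds38.seedJuntaHardXS_slack'`: `SeedJuntaHardXS`-shape with budget `3·#W ≤ N` VERBATIM, schedule
`N/(log₂N)^E + (log₂N)^{2C+E}·(50(j+1) + D·log₂N)`, arbitrary overlaps of the outside reads — UNCONDITIONAL, ONE `θ < 1` for all `E, C`.
§3 ★ `perOutputForms_structured_slackX'` ((J3)ˣ, canonical guess, `r` forms per output) and ★ `perOutputForms_structured_slack_walk'`
(WALK coordinates, charge `n + 2`, the class of `BlockFibre37.PerOutputFormsHardConst` with decomposed private forms), budget `3·#W ≤ N`.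
So the only price of unconditionality on the structured side of (J3) is the additive slack `N/(log₂N)^E` in the SEED SCHEDULE; (R1) in
the dense-overlap regime would remove exactly that.  WHAT THIS IS NOT: nothing on case (B) (heavy remainders); charge `n + 2` only in §3;
crux `stmt-QuantumAdvantage-22907` untouched; no ledger item (D-0168 shelf).
-/


noncomputable section

namespace Summit.QuantumAdvantage.AdviceFreeQNC0

open Finset Literature.Computability.QuantumComplexity Literature.Computability.QuantumComplexity.RingHLF
open Literature.Computability.MetaComplexity

/-! ## §1 The (R1)-shaped slack bound for every read family, original tolerance set -/

namespace AffBells22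

open scoped Classical in
/-- **(R1)-SHAPED SLACK BOUND FOR EVERY READ FAMILY.**  For `N ≥ 4`, every tolerance set `W`, every strategy whose bell `k` reads `T k` with
`#(T k ∖ W) ≤ (log₂N)^C`, and every `β`:
`‖Σ_x e₃(β·x)[OddZeros x ∧ Rel x (g x)]‖ ≤ 2·(39/40)^{(#(supp β ∖ W) − N/(log₂N)^E)/(log₂N)^{2C+E}}·2^N` (natural subtraction and division).
The enlargement `W' ⊇ W` of `norm_twistedWinSum_le_of_enlargedTolerance` (threshold `(log₂N)^{2C+E}`) adds `≤ N·(log₂N)^{2C}/(log₂N)^{2C+E} =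
N/(log₂N)^E` letters, and `#(supp β ∖ W') ≥ #(supp β ∖ W) − #(W' ∖ W)`; `W'` never leaves the proof. -/
theorem norm_twistedWinSum_le_slack (E C : ℕ) {N : ℕ} (hN : 4 ≤ N) (W : Finset (Fin N)) (T : Fin N → Finset (Fin N))
    (g : Fin N → (Fin N → Bool) → Bool) (hg : ∀ k, ReadsOnly (T k) (g k))
    (hT : ∀ k, (T k \ W).card ≤ (Nat.log 2 N) ^ C) (β : Fin N → ZMod 3) :
    ‖∑ x : Fin N → Bool, (ZMod.stdAddChar (∑ i : Fin N, if x i then β i else 0) : ℂ) *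
        (if (OddZeros x ∧ RingHLF.Rel x (fun k => g k x)) then (1 : ℂ) else 0)‖
      ≤ 2 * (39 / 40 : ℝ) ^ (((univ.filter fun i : Fin N => i ∉ W ∧ β i ≠ 0).card - N / Nat.log 2 N ^ E)
          / Nat.log 2 N ^ (2 * C + E)) * (2 : ℝ) ^ N := by
  have hN3 : 3 ≤ N := by omega
  set L : ℕ := Nat.log 2 N with hL
  have hL2 : 2 ≤ L := by rw [hL]; exact Nat.le_log_of_pow_le (by norm_num) (by simpa using hN)
  have hLpos : 0 < L := by omega
  have ht : 1 ≤ L ^ (2 * C + E) := Nat.one_le_pow _ _ hLpos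
  obtain ⟨W', hWW', hcard, hbound⟩ :=
    norm_twistedWinSum_le_of_enlargedTolerance hN3 W T g hg (t := L ^ (2 * C + E)) ht β
  refine hbound.trans ?_
  have hsum : ∑ k : Fin N, (T k \ W).card * ((T k \ W).card - 1) ≤ N * L ^ (2 * C) := by
    calc ∑ k : Fin N, (T k \ W).card * ((T k \ W).card - 1)
        ≤ ∑ _k : Fin N, L ^ C * L ^ C :=
          sum_le_sum fun k _ => Nat.mul_le_mul (hT k) (le_trans (Nat.sub_le _ _) (hT k))
      _ = N * L ^ (2 * C) := by
          rw [sum_const, card_univ, Fintype.card_fin, smul_eq_mul, ← pow_add, two_mul]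
  have hdiff : W'.card - W.card ≤ N / L ^ E := by
    rw [Nat.le_div_iff_mul_le (pow_pos hLpos E)]
    have h1 : L ^ (2 * C + E) * (W'.card - W.card) ≤ N * L ^ (2 * C) := hcard.trans hsum
    have h2 : L ^ (2 * C) * ((W'.card - W.card) * L ^ E) ≤ L ^ (2 * C) * N := by
      calc L ^ (2 * C) * ((W'.card - W.card) * L ^ E) = L ^ (2 * C + E) * (W'.card - W.card) := by
            rw [pow_add]; ring
        _ ≤ N * L ^ (2 * C) := h1
        _ = L ^ (2 * C) * N := mul_comm _ _
    exact Nat.le_of_mul_le_mul_left h2 (pow_pos hLpos _)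
  have hmono := GradedSeeds38.card_filter_notMem_le hWW' (fun i : Fin N => β i ≠ 0)
  have hexp : ((univ.filter fun i : Fin N => i ∉ W ∧ β i ≠ 0).card - N / L ^ E) / L ^ (2 * C + E)
      ≤ (univ.filter fun i : Fin N => i ∉ W' ∧ β i ≠ 0).card / L ^ (2 * C + E) := by
    apply Nat.div_le_div_right
    omega
  have hρ0 : (0 : ℝ) ≤ 39 / 40 := by norm_num
  have hρ1 : (39 / 40 : ℝ) ≤ 1 := by norm_num
  have hpow := pow_le_pow_of_le_one hρ0 hρ1 hexp
  have h2N : (0 : ℝ) ≤ (2 : ℝ) ^ N := by positivity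
  nlinarith [hpow, h2N, mul_nonneg (sub_nonneg.mpr hpow) h2N]

end AffBells22

/-! ## §2 The reduction for a slack twisted bound, and the structured branch with the budget verbatim -/

namespace GradedSeeds38

open TwistedJunta36

section SlackReduction

open scoped Classical in
/-- **The graded-seed reduction for a SLACK twisted bound, with the main-term constant explicit.**  Given the cover-hardness constant `θ`
of the main term (the body of `AffBells34.coverPolylogHard`, passed as the hypothesis `hcover` so that the output constant `(1 + θ)/2` is the
same real number for every slack/level choice): if for every level `C` the twisted win-sums of `W`-tolerant `(log₂N)^C`-junta strategies are
`≤ N^A·ρ^{(#(supp β∖W) − slack C N)/lvl C N}·2^N` (any slack and level functions, `lvl C N ≥ 1` for `N ≥ 2`), then seeds graded-spread outside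
`W` with schedule `slack C N + lvl C N·(α(j+1) + D·log₂N)` ⊕ such juntas win on `≤ ((1 + θ)/2)·2^{N−1}` odd inputs (`3ρ^α < 1`; budget
`3·#W ≤ N` as in `SeedJuntaHardXS`).  Proof = `seedJuntaHard_of_restrictedR1C` verbatim (graded expansion, geometric error); only the
arithmetic turning the spread into the exponent changes. -/
theorem seedJuntaHard_of_slackR1 (slack lvl : ℕ → ℕ → ℕ) (hlvl : ∀ C N, 2 ≤ N → 1 ≤ lvl C N)
    {θ : ℝ} (hθ : θ < 1)
    (hcover : ∀ C : ℕ, ∃ n₀ : ℕ, ∀ N ≥ n₀,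
      ∀ (W : Finset (Fin N)) (T : Fin N → Finset (Fin N)) (g : Fin N → (Fin N → Bool) → Bool),
        3 * W.card ≤ N → (∀ k, (T k \ W).card ≤ (Nat.log 2 N) ^ C) → (∀ k, AffBells22.ReadsOnly (T k) (g k)) →
          (AffBells22.winCount (fun x k => g k x) : ℝ) ≤ θ * (2 : ℝ) ^ (N - 1))
    {ρ : ℝ} {α : ℕ} (hρ : 0 ≤ ρ) (hq : 3 * ρ ^ α < 1)
    (hTJ : ∀ C : ℕ, ∃ A n₀ : ℕ, ∀ N ≥ n₀,
      ∀ (W : Finset (Fin N)) (T : Fin N → Finset (Fin N)) (g : Fin N → (Fin N → Bool) → Bool),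
        3 * W.card ≤ N → (∀ k, (T k \ W).card ≤ (Nat.log 2 N) ^ C) →
        (∀ k (x x' : Fin N → Bool), (∀ i ∈ T k, x i = x' i) → g k x = g k x') →
          ∀ β : Fin N → ZMod 3,
            ‖∑ x : Fin N → Bool, (ZMod.stdAddChar (∑ i : Fin N, if x i then β i else 0) : ℂ) *
                (if (OddZeros x ∧ RingHLF.Rel x (fun k => g k x)) then (1 : ℂ) else 0)‖
              ≤ (N : ℝ) ^ A * ρ ^ (((univ.filter fun i : Fin N => i ∉ W ∧ β i ≠ 0).card - slack C N) / lvl C N)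
                  * (2 : ℝ) ^ N) :
    ∀ C : ℕ, ∃ D n₀ : ℕ, ∀ N ≥ n₀,
      ∀ (W : Finset (Fin N)) (R : ℕ) (c : Fin R → Fin N → ZMod 3) (T : Fin N → Finset (Fin N))
        (H : Fin N → (Fin R → ZMod 3) → (Fin N → Bool) → Bool),
        3 * W.card ≤ N → GradedSpreadOff W c (fun j => slack C N + lvl C N * (α * (j.val + 1) + D * Nat.log 2 N)) →
        (∀ k, (T k \ W).card ≤ (Nat.log 2 N) ^ C) →
        (∀ k v (x x' : Fin N → Bool), (∀ i ∈ T k, x i = x' i) → H k v x = H k v x') →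
          ((univ.filter fun x : Fin N → Bool =>
              OddZeros x ∧ RingHLF.Rel x (fun k => H k (LinForms.resVec c x) x)).card : ℝ)
            ≤ (1 + θ) / 2 * (2 : ℝ) ^ (N - 1) := by
  classical
  intro C
  obtain ⟨n₁, hn₁⟩ := hcover C
  obtain ⟨A, n₂, hn₂⟩ := hTJ C
  have hρα0 : 0 ≤ ρ ^ α := pow_nonneg hρ α
  have hq0 : 0 ≤ 3 * ρ ^ α := by positivity
  have hρα : ρ ^ α ≤ 1 / 2 := by linarith
  have hρ1 : ρ ≤ 1 := by
    by_contra h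
    have h1 : 1 ≤ ρ ^ α := one_le_pow₀ (le_of_lt (not_le.1 h))
    linarith
  have h1θ : 0 < (1 - θ) / 2 := by linarith
  obtain ⟨n₃, hn₃⟩ : ∃ n₃ : ℕ, (2 : ℝ) ^ (A + 2) * (3 * ρ ^ α / (1 - 3 * ρ ^ α)) / ((1 - θ) / 2) ≤ n₃ :=
    ⟨_, Nat.le_ceil _⟩
  refine ⟨α * (A + 1), max (max n₁ n₂) (max n₃ 2), fun N hN W R c T H hW hspread hT hH => ?_⟩
  have hN1 : n₁ ≤ N := le_trans (le_trans (le_max_left _ _) (le_max_left _ _)) hN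
  have hN2 : n₂ ≤ N := le_trans (le_trans (le_max_right _ _) (le_max_left _ _)) hN
  have hN3 : n₃ ≤ N := le_trans (le_trans (le_max_left _ _) (le_max_right _ _)) hN
  have hNtwo : 2 ≤ N := le_trans (le_trans (le_max_right _ _) (le_max_right _ _)) hN
  have hNone : 1 ≤ N := by omega
  have hNpos : (0 : ℝ) < N := by exact_mod_cast hNone
  set L : ℕ := Nat.log 2 N with hL
  set P : (Fin R → ZMod 3) → (Fin N → Bool) → Prop := fun v x =>
    OddZeros x ∧ RingHLF.Rel x (fun k => H k v x) with hP
  set Bj : Fin R → ℝ := fun j => (N : ℝ) ^ A * ρ ^ (α * (j.val + 1) + α * (A + 1) * L) * (2 : ℝ) ^ N with hBj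
  have hBj0 : ∀ j, 0 ≤ Bj j := fun j => by positivity
  have ha : ∀ v : Fin R → ZMod 3,
      ∑ x : Fin N → Bool, (if P v x then (1 : ℝ) else 0) ≤ θ * (2 : ℝ) ^ (N - 1) := by
    intro v
    have h := hn₁ N hN1 W T (fun k x => H k v x) hW hT (fun k => fun x x' hxx' => hH k v x x' hxx')
    rw [sum_boole]
    simpa [AffBells22.winCount, hP] using h
  have hb : ∀ (v γ : Fin R → ZMod 3) (j : Fin R), IsTop γ j →
      ‖∑ x : Fin N → Bool, (ZMod.stdAddChar (∑ i, γ i * LinForms.resVec c x i) : ℂ) *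
          ((if P v x then (1 : ℝ) else 0 : ℝ) : ℂ)‖ ≤ Bj j := by
    intro v γ j hj
    set β : Fin N → ZMod 3 := fun m => ∑ i, γ i * c i m with hβ
    have hres : ∀ x : Fin N → Bool, ∑ i, γ i * LinForms.resVec c x i = ∑ m, if x m then β m else 0 := by
      intro x
      simp only [LinForms.resVec, hβ, mul_sum]
      rw [sum_comm]
      refine sum_congr rfl fun m _ => ?_
      split_ifs <;> simp
    have h := hn₂ N hN2 W T (fun k x => H k v x) hW hT (fun k x x' hxx' => hH k v x x' hxx') β
    have hcast : ∀ x : Fin N → Bool, (((if P v x then (1 : ℝ) else 0 : ℝ)) : ℂ) = (if P v x then (1 : ℂ) else 0) := by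
      intro x; split_ifs <;> simp
    simp_rw [hres, hcast]
    refine le_trans (by simpa [hP] using h) ?_
    have hlv : 0 < lvl C N := hlvl C N hNtwo
    have hw0 : slack C N + lvl C N * (α * (j.val + 1) + α * (A + 1) * L)
        ≤ (univ.filter fun i : Fin N => i ∉ W ∧ β i ≠ 0).card := hspread γ j hj
    have hw : α * (j.val + 1) + α * (A + 1) * L
        ≤ ((univ.filter fun i : Fin N => i ∉ W ∧ β i ≠ 0).card - slack C N) / lvl C N := by
      rw [Nat.le_div_iff_mul_le hlv, mul_comm]
      omega
    calc (N : ℝ) ^ A * ρ ^ (((univ.filter fun i : Fin N => i ∉ W ∧ β i ≠ 0).card - slack C N) / lvl C N) * (2 : ℝ) ^ N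
        ≤ (N : ℝ) ^ A * ρ ^ (α * (j.val + 1) + α * (A + 1) * L) * (2 : ℝ) ^ N := by
          gcongr _ * ?_ * _
          exact pow_le_pow_of_le_one hρ hρ1 hw
      _ = Bj j := rfl
  have hmain := sum_le_max_add_graded (p := 3) (fun x : Fin N → Bool => LinForms.resVec c x)
    (fun v x => if P v x then (1 : ℝ) else 0) (θ * (2 : ℝ) ^ (N - 1)) Bj hBj0 ha hb
  have hset : ((univ.filter fun x : Fin N → Bool =>
      OddZeros x ∧ RingHLF.Rel x (fun k => H k (LinForms.resVec c x) x)).card : ℝ)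
      = ∑ x : Fin N → Bool, (if P (LinForms.resVec c x) x then (1 : ℝ) else 0) := by
    rw [sum_boole]
  rw [hset]
  refine hmain.trans ?_
  have herr : ∑ j : Fin R, ((3 : ℕ) : ℝ) ^ (j.val + 1) * Bj j ≤ ((1 - θ) / 2) * (2 : ℝ) ^ (N - 1) := by
    have hterm : ∀ j : Fin R, ((3 : ℕ) : ℝ) ^ (j.val + 1) * Bj j =
        (3 * ρ ^ α) ^ (j.val + 1) * ((N : ℝ) ^ A * (ρ ^ α) ^ ((A + 1) * L) * (2 : ℝ) ^ N) := by
      intro j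
      have e1 : ρ ^ (α * (j.val + 1) + α * (A + 1) * L) = (ρ ^ α) ^ (j.val + 1) * (ρ ^ α) ^ ((A + 1) * L) := by
        rw [pow_add, pow_mul, mul_assoc, pow_mul]
      have eB : Bj j = (N : ℝ) ^ A * ρ ^ (α * (j.val + 1) + α * (A + 1) * L) * (2 : ℝ) ^ N := rfl
      rw [eB, e1, mul_pow]; push_cast; ring
    rw [sum_congr rfl fun j _ => hterm j, ← sum_mul]
    have hN2 : (2 : ℝ) ^ N = 2 * (2 : ℝ) ^ (N - 1) := by
      rw [← pow_succ']; congr 1; omega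
    have hgeo := sum_pow_succ_le_div (3 * ρ ^ α) hq0 hq R
    have hdec := pow_mul_decay_le N A hNone (ρ ^ α) hρα0 hρα
    have hq1 : 0 < 1 - 3 * ρ ^ α := by linarith
    have hK0 : 0 ≤ 3 * ρ ^ α / (1 - 3 * ρ ^ α) := div_nonneg hq0 hq1.le
    have hp : (0 : ℝ) ≤ (2 : ℝ) ^ (N - 1) := by positivity
    have hN3' : (2 : ℝ) ^ (A + 2) * (3 * ρ ^ α / (1 - 3 * ρ ^ α)) / ((1 - θ) / 2) ≤ N :=
      hn₃.trans (by exact_mod_cast hN3)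
    have hkey : (2 : ℝ) ^ (A + 2) * (3 * ρ ^ α / (1 - 3 * ρ ^ α)) / N ≤ (1 - θ) / 2 := by
      rw [div_le_iff₀ hNpos]
      rw [div_le_iff₀ h1θ] at hN3'
      linarith
    calc (∑ j : Fin R, (3 * ρ ^ α) ^ (j.val + 1)) * ((N : ℝ) ^ A * (ρ ^ α) ^ ((A + 1) * L) * (2 : ℝ) ^ N)
        ≤ (3 * ρ ^ α / (1 - 3 * ρ ^ α)) * ((2 : ℝ) ^ (A + 1) / N * (2 : ℝ) ^ N) := by
          refine mul_le_mul hgeo ?_ (by positivity) hK0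
          exact mul_le_mul_of_nonneg_right hdec (by positivity)
      _ = ((2 : ℝ) ^ (A + 2) * (3 * ρ ^ α / (1 - 3 * ρ ^ α)) / N) * (2 : ℝ) ^ (N - 1) := by
          rw [hN2]; ring
      _ ≤ ((1 - θ) / 2) * (2 : ℝ) ^ (N - 1) := mul_le_mul_of_nonneg_right hkey hp
  have h3 : ∑ j : Fin R, ((3 : ℕ) : ℝ) ^ (j.val + 1) * Bj j = ∑ j : Fin R, (3 : ℝ) ^ (j.val + 1) * Bj j := by
    push_cast; rfl
  linarith [herr]

end SlackReduction

open AffBells22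

open scoped Classical in
/-- The slack twisted bound of §1 in the hypothesis format of `seedJuntaHard_of_slackR1` (`A = 1`, `n₀ = 4`; `3·#W ≤ N` unused). -/
theorem twistedBound_slack (E C : ℕ) :
    ∃ A n₀ : ℕ, ∀ N ≥ n₀,
      ∀ (W : Finset (Fin N)) (T : Fin N → Finset (Fin N)) (g : Fin N → (Fin N → Bool) → Bool),
        3 * W.card ≤ N → (∀ k, (T k \ W).card ≤ (Nat.log 2 N) ^ C) →
        (∀ k (x x' : Fin N → Bool), (∀ i ∈ T k, x i = x' i) → g k x = g k x') →
          ∀ β : Fin N → ZMod 3,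
            ‖∑ x : Fin N → Bool, (ZMod.stdAddChar (∑ i : Fin N, if x i then β i else 0) : ℂ) *
                (if (OddZeros x ∧ RingHLF.Rel x (fun k => g k x)) then (1 : ℂ) else 0)‖
              ≤ (N : ℝ) ^ A * (39 / 40 : ℝ) ^
                  (((univ.filter fun i : Fin N => i ∉ W ∧ β i ≠ 0).card - N / Nat.log 2 N ^ E)
                    / Nat.log 2 N ^ (2 * C + E)) * (2 : ℝ) ^ N := by
  classical
  refine ⟨1, 4, fun N hN W T g _hW hT hg β => ?_⟩
  have hTr : ∀ k, ReadsOnly (T k) (g k) := fun k x x' h => hg k x x' h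
  have h := norm_twistedWinSum_le_slack E C hN W T g hTr hT β
  refine h.trans ?_
  rw [pow_one]
  have hN2 : (2 : ℝ) ≤ (N : ℝ) := by exact_mod_cast (show 2 ≤ N by omega)
  have hpos : (0 : ℝ) ≤ (39 / 40 : ℝ) ^ (((univ.filter fun i : Fin N => i ∉ W ∧ β i ≠ 0).card - N / Nat.log 2 N ^ E)
      / Nat.log 2 N ^ (2 * C + E)) * (2 : ℝ) ^ N := by positivity
  nlinarith [hpos, hN2]

open scoped Classical in
/-- ★★ **THE STRUCTURED BRANCH FOR ARBITRARY OUTSIDE READS — UNCONDITIONAL, BUDGET VERBATIM.**  ONE `θ < 1` such that for every `E, C` there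
are `D, n₀` with: for `N ≥ n₀`, every tolerance set `W` with `3·#W ≤ N`, every seed sequence `c` (any length) graded-spread outside `W` with the
slack schedule `N/(log₂N)^E + (log₂N)^{2C+E}·(50(j+1) + D·log₂N)`, and every family of juntas `H k (seed residues) x` reading `T k` with
`#(T k ∖ W) ≤ (log₂N)^C` — arbitrary overlaps, multiplicities, co-degrees — the strategy `x ↦ H k (resVec c x) x` wins on `≤ θ·2^{N−1}` odd
inputs.  `= SeedJuntaHardXS 50` with the schedule's level `C` replaced by `2C + E` and the additive slack `N/(log₂N)^E`; no (R1)
(`seedJuntaHard_of_slackR1` + `twistedBound_slack`).  Meaningful for `E ≥ 1`. -/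
theorem seedJuntaHardXS_slack' :
    ∃ θ : ℝ, θ < 1 ∧ ∀ E C : ℕ, ∃ D n₀ : ℕ, ∀ N ≥ n₀,
      ∀ (W : Finset (Fin N)) (R : ℕ) (c : Fin R → Fin N → ZMod 3) (T : Fin N → Finset (Fin N))
        (H : Fin N → (Fin R → ZMod 3) → (Fin N → Bool) → Bool),
        3 * W.card ≤ N →
        GradedSpreadOff W c (fun j =>
          N / Nat.log 2 N ^ E + (Nat.log 2 N) ^ (2 * C + E) * (50 * (j.val + 1) + D * Nat.log 2 N)) →
        (∀ k, (T k \ W).card ≤ (Nat.log 2 N) ^ C) →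
        (∀ k v (x x' : Fin N → Bool), (∀ i ∈ T k, x i = x' i) → H k v x = H k v x') →
          ((univ.filter fun x : Fin N → Bool =>
              OddZeros x ∧ RingHLF.Rel x (fun k => H k (LinForms.resVec c x) x)).card : ℝ)
            ≤ θ * (2 : ℝ) ^ (N - 1) := by
  obtain ⟨θ, hθ, hcover⟩ := AffBells34.coverPolylogHard
  refine ⟨(1 + θ) / 2, by linarith, fun E C => ?_⟩
  exact seedJuntaHard_of_slackR1 (fun _ N => N / Nat.log 2 N ^ E) (fun C N => Nat.log 2 N ^ (2 * C + E))
    (fun C N hN => Nat.one_le_pow _ _ (Nat.log_pos (by norm_num) hN)) hθ hcover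
    (ρ := 39 / 40) (α := 50) (by norm_num) three_mul_rho_pow_fifty_lt_one (fun C => twistedBound_slack E C) C

/-! ## §3 The (J3)ˣ and WALK formats with the budget verbatim -/

open LinJunta39

open scoped Classical in
/-- ★ **(J3)ˣ, STRUCTURED BRANCH, `r` PRIVATE FORMS PER OUTPUT — UNCONDITIONAL, budget `3·#W ≤ N`** (as `perOutputForms_structured_slackX`
of `SeedJuntaSlack39Walk`, budget verbatim, one `θ` for all `E, C`): strategies `x ↦ tGuess x k ⊕ F k (⟨ℓ_{k,i},x⟩)_{i<r}` with
`ℓ_{k,i} = Σ_t a_{k,i,t} c_t + rem_{k,i}`, `c` graded-spread outside `W` under the slack schedule, `#(⋃_i supp rem_{k,i} ∖ W) + 2 ≤ (log₂N)^C`,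
win on `≤ θ·2^{N−1}` odd inputs. -/
theorem perOutputForms_structured_slackX' :
    ∃ θ : ℝ, θ < 1 ∧ ∀ E C : ℕ, ∃ D n₀ : ℕ, ∀ N ≥ n₀,
      ∀ (W : Finset (Fin N)) (r : ℕ) (ℓ : Fin N → Fin r → Fin N → ZMod 3) (F : Fin N → (Fin r → ZMod 3) → Bool)
        (R : ℕ) (c : Fin R → Fin N → ZMod 3) (a : Fin N → Fin r → Fin R → ZMod 3) (rem : Fin N → Fin r → Fin N → ZMod 3),
        3 * W.card ≤ N →
        (∀ k i m, ℓ k i m = ∑ t, a k i t * c t m + rem k i m) →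
        GradedSpreadOff W c (fun j =>
          N / Nat.log 2 N ^ E + (Nat.log 2 N) ^ (2 * C + E) * (50 * (j.val + 1) + D * Nat.log 2 N)) →
        (∀ k, ((univ : Finset (Fin r)).biUnion fun i => suppOff W (rem k i)).card + 2 ≤ (Nat.log 2 N) ^ C) →
          ((univ.filter fun x : Fin N → Bool =>
              OddZeros x ∧ RingHLF.Rel x (fun k => xor (tGuess x k) (F k (fun i => linVal (ℓ k i) x)))).card : ℝ)
            ≤ θ * (2 : ℝ) ^ (N - 1) := by
  obtain ⟨θ, hθ, hall⟩ := seedJuntaHardXS_slack'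
  refine ⟨θ, hθ, fun E C => ?_⟩
  obtain ⟨D, n₀, hD⟩ := hall E C
  refine ⟨D, n₀, fun N hN W r ℓ F R c a rem hW hdec hspread hr => ?_⟩
  set T : Fin N → Finset (Fin N) := fun k =>
    ((univ : Finset (Fin r)).biUnion fun i => suppOff W (rem k i)) ∪ W ∪ {k, nxt k} with hTdef
  have hT : ∀ k, (T k \ W).card ≤ (Nat.log 2 N) ^ C := fun k =>
    (card_union_tol_pair_sdiff_le _ W k).trans (hr k)
  have hmemT : ∀ (k : Fin N) (i : Fin r), ∀ m ∈ suppOff W (rem k i) ∪ W, m ∈ T k := by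
    intro k i m hm
    rw [mem_union] at hm
    rcases hm with hm | hm
    · exact mem_union_left _ (mem_union_left _ (mem_biUnion.mpr ⟨i, mem_univ _, hm⟩))
    · exact mem_union_left _ (mem_union_right _ hm)
  have hkT : ∀ k : Fin N, k ∈ T k := fun k => by simp [hTdef]
  have hkT' : ∀ k : Fin N, nxt k ∈ T k := fun k => by simp [hTdef]
  have hH : ∀ k (v : Fin R → ZMod 3) (x x' : Fin N → Bool), (∀ m ∈ T k, x m = x' m) →
      xor (tGuess x k) (F k (fun i => ∑ t, a k i t * v t + linVal (rem k i) x))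
        = xor (tGuess x' k) (F k (fun i => ∑ t, a k i t * v t + linVal (rem k i) x')) := by
    intro k v x x' hxx'
    rw [tGuess_congr k (hxx' k (hkT k)) (hxx' (nxt k) (hkT' k))]
    congr 2
    funext i
    rw [linVal_readsOnly W (rem k i) x x' fun m hm => hxx' m (hmemT k i m hm)]
  have h := hD N hN W R c T
    (fun k v x => xor (tGuess x k) (F k (fun i => ∑ t, a k i t * v t + linVal (rem k i) x))) hW hspread hT hH
  have hlin : ∀ (k : Fin N) (i : Fin r) (x : Fin N → Bool),
      linVal (ℓ k i) x = ∑ t, a k i t * LinForms.resVec c x t + linVal (rem k i) x :=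
    fun k i x => linVal_decomp c (a k i) (rem k i) (ℓ k i) (hdec k i) x
  have hset : (univ.filter fun x : Fin N → Bool =>
        OddZeros x ∧ RingHLF.Rel x (fun k => xor (tGuess x k) (F k (fun i => linVal (ℓ k i) x))))
      = univ.filter fun x : Fin N → Bool => OddZeros x ∧ RingHLF.Rel x (fun k =>
          xor (tGuess x k) (F k (fun i => ∑ t, a k i t * LinForms.resVec c x t + linVal (rem k i) x))) := by
    refine filter_congr fun x _ => ?_
    simp only [hlin]
  rw [hset]
  exact h

open scoped Classical in
/-- ★ **(J3) IN WALK COORDINATES, STRUCTURED BRANCH — UNCONDITIONAL, budget `3·#W ≤ N` (charge `n + 2`)**: for `n ≥ n₀` (`N := n + 1`)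
every (J3)-strategy `u ↦ (F g (gateSum (ℓ g i) u)_{i<r})_g` of `BlockFibre37.PerOutputFormsHardConst`'s class (gate sums written out) with
`ℓ_{g,i} = Σ_t a_{g,i,t} c_t + rem_{g,i}`, `c` graded-spread outside `W` under the slack schedule, `#(⋃_i supp rem_{g,i} ∖ W) + 2 ≤ (log₂N)^C`,
WINS at the ring charge `n + 2` on at most `θ·2ⁿ` inputs (transport as in `perOutputForms_structured_slack_walk`). -/
theorem perOutputForms_structured_slack_walk' :
    ∃ θ : ℝ, θ < 1 ∧ ∀ E C : ℕ, ∃ D n₀ : ℕ, ∀ n ≥ n₀,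
      ∀ (W : Finset (Fin (n + 1))) (r : ℕ) (ℓ : Fin (n + 1) → Fin r → Fin (n + 1) → ZMod 3)
        (F : Fin (n + 1) → (Fin r → ZMod 3) → Bool)
        (R : ℕ) (c : Fin R → Fin (n + 1) → ZMod 3) (a : Fin (n + 1) → Fin r → Fin R → ZMod 3)
        (rem : Fin (n + 1) → Fin r → Fin (n + 1) → ZMod 3),
        3 * W.card ≤ n + 1 →
        (∀ g i m, ℓ g i m = ∑ t, a g i t * c t m + rem g i m) →
        GradedSpreadOff W c (fun j =>
          (n + 1) / Nat.log 2 (n + 1) ^ E + (Nat.log 2 (n + 1)) ^ (2 * C + E) * (50 * (j.val + 1) + D * Nat.log 2 (n + 1))) →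
        (∀ g, ((univ : Finset (Fin r)).biUnion fun i => suppOff W (rem g i)).card + 2 ≤ (Nat.log 2 (n + 1)) ^ C) →
          ((univ.filter fun u : Fin n → Bool =>
              ringWinU (n + 2) (fun g u => F g (fun i => ∑ m : Fin (n + 1), if xOfU u m = true then ℓ g i m else 0)) u
                = true).card : ℝ) ≤ θ * (2 : ℝ) ^ n := by
  classical
  obtain ⟨θ, hθ, hall⟩ := perOutputForms_structured_slackX'
  refine ⟨θ, hθ, fun E C => ?_⟩
  obtain ⟨D, n₀, hD⟩ := hall E C
  refine ⟨D, max n₀ 2, fun n hn W r ℓ F R c a rem hW hdec hspread hr => ?_⟩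
  have hn₀ : n₀ ≤ n + 1 := by have := le_max_left n₀ 2; omega
  have hn2 : 2 ≤ n := le_trans (le_max_right _ _) hn
  set z : (Fin (n + 1) → Bool) → (Fin (n + 1) → Bool) :=
    fun x k => xor (tGuess x k) (F k (fun i => linVal (ℓ k i) x)) with hz
  have hx := hD (n + 1) hn₀ W r ℓ F R c a rem hW hdec hspread hr
  rw [Nat.add_sub_cancel] at hx
  set y : Fin (n + 1) → (Fin n → Bool) → Bool :=
    fun g u => F g (fun i => ∑ m : Fin (n + 1), if xOfU u m = true then ℓ g i m else 0) with hy
  have hy' : (fun (g : Fin (n + 1)) (u : Fin n → Bool) => xor (z (xOfU u) g) (tGuess (xOfU u) g)) = y := by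
    funext g u
    have e : (fun i => linVal (ℓ g i) (xOfU u)) = fun i => ∑ m : Fin (n + 1), if xOfU u m = true then ℓ g i m else 0 := rfl
    simp only [hz, hy, ← e]
    generalize tGuess (xOfU u) g = t
    generalize F g (fun i => linVal (ℓ g i) (xOfU u)) = d
    cases t <;> cases d <;> rfl
  have h1 := card_filter_le_card_odd hn2 (fun u : Fin n → Bool => ringWinU (n + 2) y u = true)
  have h2 : (univ.filter fun x : Fin (n + 1) → Bool =>
        (univ.filter fun j : Fin (n + 1) => x j = false).card % 2 = 1 ∧ ringWinU (n + 2) y (uVec x) = true)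
      ⊆ univ.filter fun x : Fin (n + 1) → Bool => OddZeros x ∧ RingHLF.Rel x (z x) := by
    intro x hx'
    rw [mem_filter] at hx' ⊢
    refine ⟨mem_univ _, hx'.2.1, ?_⟩
    rw [rel_iff_ringWinU hn2 x hx'.2.1 z, hy']
    exact hx'.2.2
  have h3 := h1.trans (Finset.card_le_card h2)
  calc ((univ.filter fun u : Fin n → Bool => ringWinU (n + 2) y u = true).card : ℝ)
      ≤ ((univ.filter fun x : Fin (n + 1) → Bool => OddZeros x ∧ RingHLF.Rel x (z x)).card : ℝ) := by
        exact_mod_cast h3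
    _ ≤ θ * (2 : ℝ) ^ n := hx

end GradedSeeds38

end Summit.QuantumAdvantage.AdviceFreeQNC0

end
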